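/-
b2b-lace packet, LEAN TYPING SEAT 2 gen 14 (unit `b2b-lace-lean2-g14`).  A dimension-free structural lemma the packet kept using
informally ("outward rounding of the β-tables is conservative for the certificate"): the two right-hand sides of [NoBLE17] Def. 2.9 are
MONOTONE under `BetaLE`, and a numeric certificate at WEAKER tables yields one at STRONGER tables.  ADDITIVE: generic, no numeral, no
record module imported or touched, no new `def`, no named fact.
-/
import Literature.Probability.FitznerVanDerHofstad2017.NobleInstantiate
import HarnessLib

/-!
# Monotonicity of the Def. 2.9 certificate functionals under outward rounding (`BetaLE`)

CITATION HEADER (PLACEMENT v2). This module is part of a certified REPRODUCTION of: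
R. Fitzner, R. van der Hofstad, *Mean-field behavior for nearest-neighbor percolation in d > 10*,
Electron. J. Probab. 22 (2017), no. 43, 1–65 [FvdH17], and *Generalized approach to the non-backtracking
lace expansion*, Probab. Theory Related Fields 169 (2017), 1041–1119 [NoBLE17] (arXiv:1506.07977, 1506.07969).
Reproduces: an elementary property of [NoBLE17] Def. 2.9 (conditions on `γ₁`, `γ₂`) used implicitly whenever certified
intervals are rounded outward. Origin: build `lace`.

`BetaLE B B'` (`NobleInstantiate`) says the table `B'` is WEAKER than `B`: every upper-bound constant of `B'` is at least that of `B`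
and its lower-bound constant `αFlow` is at most that of `B` — the direction of outward rounding ([NoBLE17] Assumption 2.7: each β is a
one-sided bound).  `NobleInstantiate` records that the ANALYTIC hypotheses are monotone in this order (`nobleSimplifiedFormAt_mono`,
`nobleInitialInputsAt_mono`, `nobleImprovementInputsAt_mono`: a bound with `B` is a bound with `B'`).  This module records the
complementary, equally elementary fact for the NUMERICAL side:

* `BetaLE.f1Bound_le`: `max{β_μ̄, c_μ}(1+β̄_Π)/(1−(2d/(2d−1))β_Ψ)` is monotone — `B.f1Bound d cμ ≤ B'.f1Bound d cμ` whenever `0 ≤ c_μ`,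
  `0 ≤ 1 + B.βPi` and the weaker table's denominator is positive (`2d·B'.βΨ/(2d−1) < 1`);
* `BetaLE.f2Bound_le`: `((2d−1)/(2d−2))(β̄_c+β_α+β_{R,Φ})/(β_F−β_{ΔR_F})` is monotone — `B.f2Bound d ≤ B'.f2Bound d` whenever `2 ≤ d`,
  `0 ≤ B'.cΦup + B'.βαΦ + B'.βRΦ` and the weaker table is admissible in its last clause (`B'.βΔ < B'.αFlow`);
* `BetaLE.admissible_of_weaker`: admissibility (`NobleBeta.Admissible`) of the WEAKER table transfers to the stronger one, given the
  stronger table's three sign conditions `1 ≤ βμ`, `0 ≤ βPi`, `0 ≤ βΨ` (which do not transfer downward);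
* `NobleNumericCertificate.of_betaLE`: hence a certificate ([NoBLE17] Def. 2.9, `NobleNumericCertificate d cμ c γ Γ Bi' Bo' bi bo`) at
  weaker tables `Bi'`, `Bo'` gives the certificate at any stronger tables `Bi`, `Bo` (`BetaLE Bi Bi'`, `BetaLE Bo Bo'`) satisfying those
  sign conditions, with the same `γ, Γ, c_μ, c, bi, bo` (`2 ≤ d`).

READING.  Certifying the 36 inequalities at tables that are field-wise WEAKER than some other tables (e.g. at the kernel-computed image
of outward-rounded inputs rather than at tighter β-literals) is CONSERVATIVE: the certificate at the tighter tables follows.  At `d = 11`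
this is the relation between the input-level twin `D11.nobleCertificate_d11_inputs_rev7` and the record `D11.nobleCertificate_d11_rev7`
(brackets `D11.betaLE_Bi7_inputsI7`, `D11.betaLE_Bo7_inputsO7` of `MeanFieldD11Rev7Bracket`); this module is dimension-free and imports
no `d = 11` data.  Kernel facts about real-number inequalities only; nothing about a lattice quantity is asserted.
-/

noncomputable section

namespace Literature.Probability.FitznerVanDerHofstad2017

open Literature.Barriers.CriticalPhenomena

variable {d : ℕ}

/-- The coefficient `2d/(2d−1)` of `β_Ψ` in the `γ₁`-denominator is non-negative for every natural `d` (for `d = 0` it is `0/(−1) = 0`).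
[folklore] -/
theorem two_d_div_pred_nonneg (d : ℕ) : 0 ≤ (2 * (d : ℝ)) / (2 * d - 1) := by
  rcases Nat.eq_zero_or_pos d with rfl | hd
  · simp
  · have : (1 : ℝ) ≤ d := by exact_mod_cast hd
    exact div_nonneg (by positivity) (by linarith)

/-- The `β_Ψ`-term of the `γ₁`-denominator is monotone under `BetaLE`. [cite: FitznerVanDerHofstad2016NoBLE, Def. 2.9 (condition on γ₁)] -/
theorem BetaLE.psiTerm_le {B B' : NobleBeta} (h : BetaLE B B') :
    2 * (d : ℝ) * B.βΨ / (2 * d - 1) ≤ 2 * (d : ℝ) * B'.βΨ / (2 * d - 1) := by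
  have hc := two_d_div_pred_nonneg d
  have e : ∀ x : ℝ, 2 * (d : ℝ) * x / (2 * d - 1) = (2 * (d : ℝ)) / (2 * d - 1) * x := fun x => by ring
  rw [e, e]
  exact mul_le_mul_of_nonneg_left h.βΨ hc

/-- **`f₁`-side of Def. 2.9 is monotone under outward rounding.**  If `B'` is weaker than `B` (`BetaLE B B'`), `0 ≤ c_μ`, `0 ≤ 1 + B.βPi`
and the weaker table's denominator is positive, then `B.f1Bound d cμ ≤ B'.f1Bound d cμ`.
[cite: FitznerVanDerHofstad2016NoBLE, Def. 2.9 (condition on γ₁); Assumption 2.7 (one-sided bounds)] -/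
theorem BetaLE.f1Bound_le {B B' : NobleBeta} (h : BetaLE B B') {cμ : ℝ} (hcμ : 0 ≤ cμ) (hPi : 0 ≤ 1 + B.βPi)
    (hden' : 2 * (d : ℝ) * B'.βΨ / (2 * d - 1) < 1) : B.f1Bound d cμ ≤ B'.f1Bound d cμ := by
  unfold NobleBeta.f1Bound
  have hψ := h.psiTerm_le (d := d)
  have hD' : 0 < 1 - 2 * (d : ℝ) * B'.βΨ / (2 * d - 1) := by linarith
  have hD : 0 < 1 - 2 * (d : ℝ) * B.βΨ / (2 * d - 1) := by linarith
  have hmax : max B.βμ cμ ≤ max B'.βμ cμ := max_le_max h.βμ le_rfl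
  have hmax0 : 0 ≤ max B'.βμ cμ := le_max_of_le_right hcμ
  have hfrac : (1 + B.βPi) / (1 - 2 * (d : ℝ) * B.βΨ / (2 * d - 1)) ≤
      (1 + B'.βPi) / (1 - 2 * (d : ℝ) * B'.βΨ / (2 * d - 1)) := by
    have hPi' : 0 ≤ 1 + B'.βPi := by linarith [h.βPi]
    rw [div_le_div_iff₀ hD hD']
    have h1 : (1 + B.βPi) * (1 - 2 * (d : ℝ) * B'.βΨ / (2 * d - 1)) ≤
        (1 + B.βPi) * (1 - 2 * (d : ℝ) * B.βΨ / (2 * d - 1)) :=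
      mul_le_mul_of_nonneg_left (by linarith) hPi
    have h2 : (1 + B.βPi) * (1 - 2 * (d : ℝ) * B.βΨ / (2 * d - 1)) ≤
        (1 + B'.βPi) * (1 - 2 * (d : ℝ) * B.βΨ / (2 * d - 1)) :=
      mul_le_mul_of_nonneg_right (by linarith [h.βPi]) hD.le
    linarith
  have hfrac0 : 0 ≤ (1 + B.βPi) / (1 - 2 * (d : ℝ) * B.βΨ / (2 * d - 1)) := div_nonneg hPi hD.le
  exact mul_le_mul hmax hfrac hfrac0 hmax0

/-- **`f₂`-side of Def. 2.9 is monotone under outward rounding.**  If `B'` is weaker than `B` (`BetaLE B B'`), `2 ≤ d`, the weaker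
table's numerator is non-negative and its denominator positive (`B'.βΔ < B'.αFlow`), then `B.f2Bound d ≤ B'.f2Bound d`.
[cite: FitznerVanDerHofstad2016NoBLE, Def. 2.9 (condition on γ₂); Assumption 2.7 and the line following it] -/
theorem BetaLE.f2Bound_le {B B' : NobleBeta} (h : BetaLE B B') (hd : 2 ≤ d) (hN' : 0 ≤ B'.cΦup + B'.βαΦ + B'.βRΦ)
    (hden' : B'.βΔ < B'.αFlow) : B.f2Bound d ≤ B'.f2Bound d := by
  unfold NobleBeta.f2Bound
  have hd' : (2 : ℝ) ≤ d := by exact_mod_cast hd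
  have hcoef : 0 ≤ (2 * (d : ℝ) - 1) / (2 * d - 2) := div_nonneg (by linarith) (by linarith)
  have hE' : 0 < B'.αFlow - B'.βΔ := by linarith
  have hE : 0 < B.αFlow - B.βΔ := by linarith [h.αFlow, h.βΔ]
  have hfrac : (B.cΦup + B.βαΦ + B.βRΦ) / (B.αFlow - B.βΔ) ≤ (B'.cΦup + B'.βαΦ + B'.βRΦ) / (B'.αFlow - B'.βΔ) := by
    rw [div_le_div_iff₀ hE hE']
    have hN : B.cΦup + B.βαΦ + B.βRΦ ≤ B'.cΦup + B'.βαΦ + B'.βRΦ := by linarith [h.cΦup, h.βαΦ, h.βRΦ]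
    have hEE : B'.αFlow - B'.βΔ ≤ B.αFlow - B.βΔ := by linarith [h.αFlow, h.βΔ]
    by_cases hN0 : 0 ≤ B.cΦup + B.βαΦ + B.βRΦ
    · have h1 : (B.cΦup + B.βαΦ + B.βRΦ) * (B'.αFlow - B'.βΔ) ≤ (B.cΦup + B.βαΦ + B.βRΦ) * (B.αFlow - B.βΔ) :=
        mul_le_mul_of_nonneg_left hEE hN0
      have h2 : (B.cΦup + B.βαΦ + B.βRΦ) * (B.αFlow - B.βΔ) ≤ (B'.cΦup + B'.βαΦ + B'.βRΦ) * (B.αFlow - B.βΔ) :=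
        mul_le_mul_of_nonneg_right hN hE.le
      linarith
    · have hN0' : B.cΦup + B.βαΦ + B.βRΦ ≤ 0 := le_of_not_ge hN0
      have h1 : (B.cΦup + B.βαΦ + B.βRΦ) * (B'.αFlow - B'.βΔ) ≤ 0 :=
        mul_nonpos_of_nonpos_of_nonneg hN0' hE'.le
      have h2 : 0 ≤ (B'.cΦup + B'.βαΦ + B'.βRΦ) * (B.αFlow - B.βΔ) := mul_nonneg hN' hE.le
      linarith
  exact mul_le_mul_of_nonneg_left hfrac hcoef

/-- **Admissibility transfers from the weaker table to the stronger one**, given the stronger table's sign conditions `1 ≤ β_μ̄`,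
`0 ≤ β̄_Π`, `0 ≤ β_Ψ` (these three do not follow from the weaker table's).
[cite: FitznerVanDerHofstad2016NoBLE, Assumption 2.7 and the line following it; Lemma 3.2 (proof)] -/
theorem BetaLE.admissible_of_weaker {B B' : NobleBeta} (h : BetaLE B B') (h' : B'.Admissible d) (hμ : 1 ≤ B.βμ)
    (hPi : 0 ≤ B.βPi) (hΨ : 0 ≤ B.βΨ) : B.Admissible d := by
  obtain ⟨-, -, -, hden', hΔ'⟩ := h'
  refine ⟨hμ, hPi, hΨ, ?_, ?_⟩
  · exact lt_of_le_of_lt (h.psiTerm_le (d := d)) hden'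
  · linarith [h.βΔ, h.αFlow]

/-- **A numeric certificate at weaker tables gives the certificate at stronger tables** ([NoBLE17] Def. 2.9 is monotone under
outward rounding): from `NobleNumericCertificate d cμ c γ Γ Bi' Bo' bi bo`, `BetaLE Bi Bi'`, `BetaLE Bo Bo'` (`2 ≤ d`) and the sign
conditions of the stronger tables, `NobleNumericCertificate d cμ c γ Γ Bi Bo bi bo` — same `γ, Γ, c_μ, c, bi, bo`.
[cite: FitznerVanDerHofstad2016NoBLE, Def. 2.9, Assumption 2.7] -/
theorem NobleNumericCertificate.of_betaLE {cμ : ℝ} {c : Fin 6 → ℝ} {γ Γ : Fin 3 → ℝ} {Bi Bi' Bo Bo' : NobleBeta}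
    {bi bo : Fin 6 → ℝ} (hN : NobleNumericCertificate d cμ c γ Γ Bi' Bo' bi bo) (hd : 2 ≤ d)
    (hI : BetaLE Bi Bi') (hO : BetaLE Bo Bo')
    (hIμ : 1 ≤ Bi.βμ) (hIPi : 0 ≤ Bi.βPi) (hIΨ : 0 ≤ Bi.βΨ) (hIΦ : 0 ≤ Bi.cΦup + Bi.βαΦ + Bi.βRΦ)
    (hOμ : 1 ≤ Bo.βμ) (hOPi : 0 ≤ Bo.βPi) (hOΨ : 0 ≤ Bo.βΨ) (hOΦ : 0 ≤ Bo.cΦup + Bo.βαΦ + Bo.βRΦ) :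
    NobleNumericCertificate d cμ c γ Γ Bi Bo bi bo where
  one_lt_cμ := hN.one_lt_cμ
  c_pos := hN.c_pos
  γ_lt_Γ := hN.γ_lt_Γ
  admissible_init := hI.admissible_of_weaker hN.admissible_init hIμ hIPi hIΨ
  admissible := hO.admissible_of_weaker hN.admissible hOμ hOPi hOΨ
  f1Bound_init_le :=
    (hI.f1Bound_le (zero_le_one.trans hN.one_lt_cμ.le) (by linarith) hN.admissible_init.2.2.2.1).trans hN.f1Bound_init_le
  f2Bound_init_le :=
    (hI.f2Bound_le hd (by linarith [hI.cΦup, hI.βαΦ, hI.βRΦ]) hN.admissible_init.2.2.2.2).trans hN.f2Bound_init_le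
  f3_init_le := hN.f3_init_le
  f1Bound_le := (hO.f1Bound_le (zero_le_one.trans hN.one_lt_cμ.le) (by linarith) hN.admissible.2.2.2.1).trans hN.f1Bound_le
  f2Bound_le := (hO.f2Bound_le hd (by linarith [hO.cΦup, hO.βαΦ, hO.βRΦ]) hN.admissible.2.2.2.2).trans hN.f2Bound_le
  f3_le := hN.f3_le

end Literature.Probability.FitznerVanDerHofstad2017

end
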